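import Mathlib
import HarnessLib
import Summits.ResolutionOfSingularities.ResolutionOfSingularities.Theorems.WildQuotientsWildQuotientResolutionStubBirationalRankOne

/-!
# Finite étale algebras injective on spectra have rank one (crux `WildQuotients.WildQuotientResolution`, line `Sketch`)

Helper file 2/3 for stub `stub_birational_of_bijective` (lemma (L) of the skeleton `Sketch` for
crux stmt-ResolutionOfSingularities-15640): the affine, commutative-algebra form (L-alg).

* `exists_rankAtStalk_eq_one_of_transcendental` — THE ENGINE. `k` a field, `A ⊆ B` domains,
  `A` of finite type over `k` containing an element transcendental over `k`, `B` finite étale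
  over `A` with `Spec B → Spec A` injective. Then `B` has rank `1` at some prime of `A`.
  Proof: take a standard étale neighbourhood `B_f ≅ (A[X]/(m))[1/g]` of the generic point of `B`
  (Mathlib `Algebra.IsEtaleAt.exists_isStandardEtale`) with generator `x`, shifted by an element
  of `A` to make `b = x + a₀` transcendental over `k`; the image of `Spec B_f → 𝔸¹_k`
  (`Y ↦ b`) is constructible (Chevalley, `PrimeSpectrum.isConstructible_range_comap`) and
  contains the generic point, hence a non-empty open `D(g)`. Pick a closed point `(Q)` of
  `𝔸¹_k` in `D(g)`: for `k` infinite `Q = Y - c`, for `k` finite `Q` irreducible of PRIME degree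
  `e > deg m`. A maximal ideal `t ∋ Q(b)` of `B_f` has residue field `L = B_f / t` in which
  `b̄` is a root of `Q`; in the first case `b̄ = c`, in the second `[F(b̄) : F] ∈ {1, e}` for the
  subfield `F` generated by `A` (`natDegree_minpoly_eq_one_or_eq`) while `[F(b̄) : F] ≤ deg m`,
  so again `b̄ ∈ F`. Hence `x̄ ∈ F`, and `exists_rankAtStalk_eq_one` gives rank one at `t ∩ A`.
* `algebraMap_bijective_of_comap_bijective` (registered sub-goal) — (L-alg): with `Spec B → Spec A` BIJECTIVE and `A`
  not a field, `A → B` is an isomorphism (the rank of the finite flat `B` is constant on the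
  irreducible `Spec A`, equal to `1` by the engine; Mathlib
  `Module.algebraMap_bijective_iff_rankAtStalk`).

False without "not a field" (`Spec L → Spec K`) — the transcendental element is essential.
All statements are standard; no new definitions.
-/

-- single-problem summit: the doubled namespace component `ResolutionOfSingularities` is forced
set_option linter.dupNamespace false

namespace Summit.ResolutionOfSingularities.ResolutionOfSingularities.Theorems.WildQuotientResolution.Birational

open Polynomial TensorProduct
open scoped IntermediateField

/-- **The engine.** `k` a field, `A → B` an injection of domains with `A` of finite type over `k`
containing an element transcendental over `k`, `B` finite étale over `A` and `Spec B → Spec A`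
injective. Then `B` has rank one at some prime of `A` (see the module docstring for the proof:
standard étale neighbourhood of the generic point, Chevalley on `Spec B_f → 𝔸¹_k`, a closed
point of `𝔸¹_k` of degree `1` (infinite `k`) or of large prime degree (finite `k`) in the image).
[folklore] -/
theorem exists_rankAtStalk_eq_one_of_transcendental {k A B : Type*} [Field k] [CommRing A]
    [IsDomain A] [CommRing B] [IsDomain B] [Algebra k A] [Algebra k B] [Algebra A B]
    [IsScalarTower k A B] [Algebra.FiniteType k A] [Module.Finite A B] [Algebra.Etale A B]
    (ha : ∃ a : A, Transcendental k a) (hinjA : Function.Injective (algebraMap A B))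
    (hinj : Function.Injective (PrimeSpectrum.comap (algebraMap A B))) :
    ∃ u : PrimeSpectrum A, Module.rankAtStalk B u = 1 := by
  classical
  obtain ⟨a, hta⟩ := ha
  -- a standard étale neighbourhood of the generic point of `B`
  obtain ⟨f, hf0, hstd⟩ := Algebra.IsEtaleAt.exists_isStandardEtale (R := A) (⊥ : Ideal B)
  have hf : f ≠ 0 := fun h => hf0 (h ▸ Ideal.zero_mem _)
  let Bf := Localization.Away f
  obtain ⟨P⟩ := hstd.nonempty_standardEtalePresentation
  have hle : Submonoid.powers f ≤ nonZeroDivisors B :=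
    powers_le_nonZeroDivisors_of_noZeroDivisors hf
  haveI : IsDomain Bf := IsLocalization.isDomain_localization hle
  have hinjBf : Function.Injective (algebraMap B Bf) := IsLocalization.injective Bf hle
  have hinjABf : Function.Injective (algebraMap A Bf) := by
    rw [IsScalarTower.algebraMap_eq A B Bf]
    exact hinjBf.comp hinjA
  haveI : IsScalarTower k A Bf := IsScalarTower.of_algebraMap_eq fun c => by
    rw [IsScalarTower.algebraMap_apply k B Bf, IsScalarTower.algebraMap_apply k A B,
      ← IsScalarTower.algebraMap_apply A B Bf]
  -- a generator of `Bf` transcendental over `k`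
  obtain ⟨a₀, hb⟩ : ∃ a₀ : A, Transcendental k (P.x + algebraMap A Bf a₀) := by
    by_cases hx : Transcendental k P.x
    · exact ⟨0, by simpa using hx⟩
    · refine ⟨a, fun halg => hta ?_⟩
      rw [Transcendental, not_not] at hx
      have h1 : IsIntegral k (P.x + algebraMap A Bf a) := isAlgebraic_iff_isIntegral.mp halg
      have h2 : IsIntegral k P.x := isAlgebraic_iff_isIntegral.mp hx
      have h3 : IsIntegral k (algebraMap A Bf a) := by simpa using h1.sub h2
      exact (isAlgebraic_algebraMap_iff hinjABf).mp h3.isAlgebraic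
  set b := P.x + algebraMap A Bf a₀ with hbdef
  -- finiteness
  haveI : Algebra.FiniteType k B := Algebra.FiniteType.trans (S := A) inferInstance inferInstance
  haveI : Algebra.FinitePresentation B Bf := IsLocalization.Away.finitePresentation f
  haveI : Algebra.FiniteType k Bf := Algebra.FiniteType.trans (S := B) inferInstance inferInstance
  -- the dominant map `Spec Bf → 𝔸¹_k` given by `b`, and Chevalley's theorem
  let ψ : k[X] →ₐ[k] Bf := aeval b
  have hψinj : Function.Injective ψ := transcendental_iff_injective.mp hb
  have hψft : ψ.toRingHom.FiniteType := by
    refine RingHom.FiniteType.of_comp_finiteType (f := algebraMap k k[X]) ?_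
    rw [AlgHom.toRingHom_eq_coe, ψ.comp_algebraMap]
    exact RingHom.finiteType_algebraMap.mpr inferInstance
  have hψfp : ψ.toRingHom.FinitePresentation := by
    letI := ψ.toRingHom.toAlgebra
    exact Algebra.FinitePresentation.of_finiteType.mp hψft
  have hcons := PrimeSpectrum.isConstructible_range_comap hψfp
  have hgen : (⟨⊥, Ideal.isPrime_bot⟩ : PrimeSpectrum k[X]) ∈
      Set.range (PrimeSpectrum.comap ψ.toRingHom) := by
    refine ⟨⟨⊥, Ideal.isPrime_bot⟩, ?_⟩
    ext1
    simpa using Ideal.comap_bot_of_injective ψ.toRingHom hψinj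
  obtain ⟨g, hg0, hgsub⟩ := exists_basicOpen_subset_of_isConstructible hcons hgen
  -- every irreducible `Q` prime to `g` gives a maximal ideal of `Bf` containing `Q(b)`
  have key : ∀ Q : k[X], Irreducible Q → ¬ Q ∣ g →
      ∃ t : Ideal Bf, t.IsMaximal ∧ aeval b Q ∈ t := by
    intro Q hQ hQg
    let q : PrimeSpectrum k[X] :=
      ⟨Ideal.span {Q}, (Ideal.span_singleton_prime hQ.ne_zero).mpr hQ.prime⟩
    have hq : q ∈ (PrimeSpectrum.basicOpen g : Set (PrimeSpectrum k[X])) := by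
      change g ∉ Ideal.span {Q}
      rwa [Ideal.mem_span_singleton]
    obtain ⟨T, hT⟩ := hgsub hq
    have hmem : ψ Q ∈ T.asIdeal := by
      have : Q ∈ (PrimeSpectrum.comap ψ.toRingHom T).asIdeal := by
        rw [hT]; exact Ideal.mem_span_singleton_self Q
      simpa using this
    have hnu : ψ Q ∈ nonunits Bf := fun hu => T.2.ne_top (Ideal.eq_top_of_isUnit_mem _ hmem hu)
    obtain ⟨t, ht, hmem'⟩ := exists_max_ideal_of_mem_nonunits hnu
    exact ⟨t, ht, hmem'⟩
  -- it suffices to find a maximal `t` modulo which the generator `P.x` is `A`-rational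
  suffices H : ∃ (t : Ideal Bf) (_ : t.IsMaximal), letI := Ideal.Quotient.field t;
      Ideal.Quotient.mk t P.x ∈ Subfield.closure (Set.range (algebraMap A (Bf ⧸ t))) by
    obtain ⟨t, ht, hxt⟩ := H
    letI := Ideal.Quotient.field t
    exact exists_rankAtStalk_eq_one (S := Bf) (L := Bf ⧸ t) P hinj hxt
  have hmkA : ∀ (t : Ideal Bf) (y : A),
      Ideal.Quotient.mk t (algebraMap A Bf y) = algebraMap A (Bf ⧸ t) y := fun t y => rfl
  by_cases hfin : Finite k
  · -- `k` finite: a closed point of `𝔸¹_k` of large prime degree in the image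
    obtain ⟨e, he_ge, he⟩ := Nat.exists_infinite_primes (max P.f.natDegree g.natDegree + 1)
    obtain ⟨Q, hQirr, hQmon, hQdeg⟩ := exists_irreducible_natDegree_eq k e he.ne_zero
    have hQg : ¬ Q ∣ g := fun hdvd => by
      have := natDegree_le_of_dvd hdvd hg0
      omega
    obtain ⟨t, ht, hmem⟩ := key Q hQirr hQg
    refine ⟨t, ht, ?_⟩
    letI := Ideal.Quotient.field t
    let L := Bf ⧸ t
    haveI : Module.Finite k L := finite_of_finite_type_of_isJacobsonRing k L
    haveI : Finite L := Module.finite_of_finite k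
    set β : L := Ideal.Quotient.mk t b with hβdef
    have hβQ : aeval β Q = 0 := by
      change aeval (Ideal.Quotient.mkₐ k t b) Q = 0
      rw [aeval_algHom_apply, Ideal.Quotient.mkₐ_eq_mk, Ideal.Quotient.eq_zero_iff_mem]
      exact hmem
    have hminβ : minpoly k β = Q := (minpoly.eq_of_irreducible_of_monic hQirr hβQ hQmon).symm
    let F : IntermediateField k L := IntermediateField.adjoin k (Set.range (algebraMap A L))
    have hAF : ∀ y : A, algebraMap A L y ∈ F := fun y =>
      IntermediateField.subset_adjoin _ _ ⟨y, rfl⟩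
    have hF := natDegree_minpoly_eq_one_or_eq F β he (by rw [hminβ, hQdeg])
    set xb : L := Ideal.Quotient.mk t P.x with hxbdef
    have hβx : β = xb + algebraMap F L ⟨_, hAF a₀⟩ := by
      rw [hβdef, hbdef, map_add, hmkA]
      rfl
    have hdegx : (minpoly F xb).natDegree ≤ P.f.natDegree := by
      letI : Algebra A F := ((algebraMap A L).codRestrict F hAF).toAlgebra
      haveI : IsScalarTower A F L := IsScalarTower.of_algebraMap_eq fun a => rfl
      have h0 : aeval xb (P.f.map (algebraMap A F)) = 0 := by
        rw [aeval_map_algebraMap]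
        change aeval (Ideal.Quotient.mkₐ A t P.x) P.f = 0
        rw [aeval_algHom_apply, P.hasMap.1, map_zero]
      have hmon : (P.f.map (algebraMap A F)).Monic := P.monic_f.map _
      calc (minpoly F xb).natDegree ≤ (P.f.map (algebraMap A F)).natDegree :=
            natDegree_le_of_dvd (minpoly.dvd F xb h0) hmon.ne_zero
        _ = P.f.natDegree := P.monic_f.natDegree_map _
    have hdegβ : (minpoly F β).natDegree = (minpoly F xb).natDegree := by
      rw [hβx, minpoly.add_algebraMap, natDegree_comp, natDegree_X_sub_C, mul_one]
    have h1 : (minpoly F β).natDegree = 1 := by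
      rcases hF with h | h
      · exact h
      · exfalso
        rw [hdegβ] at h
        have := le_max_left P.f.natDegree g.natDegree
        omega
    have hβF : β ∈ F := by
      obtain ⟨y, hy⟩ := minpoly.natDegree_eq_one_iff.mp h1
      rw [← hy]
      exact y.2
    have hxF : xb ∈ F := by
      have : xb = β - algebraMap F L ⟨_, hAF a₀⟩ := by rw [hβx, add_sub_cancel_right]
      rw [this]
      exact sub_mem hβF (⟨_, hAF a₀⟩ : F).2
    have hrange : Set.range (algebraMap k L) ∪ Set.range (algebraMap A L) =
        Set.range (algebraMap A L) := by
      refine Set.union_eq_right.mpr ?_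
      rintro _ ⟨c, rfl⟩
      exact ⟨algebraMap k A c, (IsScalarTower.algebraMap_apply k A L c).symm⟩
    have := (IntermediateField.mem_toSubfield F xb).mpr hxF
    rwa [IntermediateField.adjoin_toSubfield, hrange] at this
  · -- `k` infinite: a rational point of `𝔸¹_k` in the image
    haveI : Infinite k := not_finite_iff_infinite.mp hfin
    obtain ⟨c, hc⟩ : ∃ c : k, g.eval c ≠ 0 := by
      by_contra! h
      exact hg0 (Polynomial.zero_of_eval_zero g h)
    obtain ⟨t, ht, hmem⟩ := key (X - C c) (irreducible_X_sub_C c) (by rwa [dvd_iff_isRoot])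
    refine ⟨t, ht, ?_⟩
    letI := Ideal.Quotient.field t
    have hb' : Ideal.Quotient.mk t b = Ideal.Quotient.mk t (algebraMap k Bf c) := by
      rw [Ideal.Quotient.eq]
      simpa using hmem
    have : Ideal.Quotient.mk t P.x = algebraMap A (Bf ⧸ t) (algebraMap k A c - a₀) := by
      rw [← hmkA, map_sub, ← IsScalarTower.algebraMap_apply, map_sub, ← hb', hbdef, map_add,
        add_sub_cancel_right]
    rw [this]
    exact Subfield.subset_closure ⟨_, rfl⟩

/-- **(L-alg): a finite étale algebra which is bijective on spectra is an isomorphism, over a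
positive-dimensional base of finite type over a field.** `k` a field, `A` a domain of finite
type over `k` which is NOT a field, `B` a domain finite étale over `A` with `Spec B → Spec A`
bijective. Then `A → B` is bijective: the rank of the finite flat `A`-module `B` is constant on
the irreducible `Spec A` (`Module.rankAtStalk_eq_of_le_of_finite_of_flat`), equal to `1` at one
prime by `exists_rankAtStalk_eq_one_of_transcendental` (a transcendental element exists since a
domain algebraic over `k` is a field), and rank `≡ 1` means `A ≅ B`
(`Module.algebraMap_bijective_iff_rankAtStalk`). False for `A` a field (`Spec L → Spec K`).
[folklore] -/
theorem algebraMap_bijective_of_comap_bijective {k A B : Type*} [Field k] [CommRing A]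
    [IsDomain A] [CommRing B] [IsDomain B] [Algebra k A] [Algebra k B] [Algebra A B]
    [IsScalarTower k A B] [Algebra.FiniteType k A] [Module.Finite A B] [Algebra.Etale A B]
    (hA : ¬ IsField A) (hbij : Function.Bijective (PrimeSpectrum.comap (algebraMap A B))) :
    Function.Bijective (algebraMap A B) := by
  have hinjA : Function.Injective (algebraMap A B) :=
    PrimeSpectrum.comap_surjective_iff_injective_of_finite.mp hbij.2
  have ha : ∃ a : A, Transcendental k a := by
    by_contra! h
    simp only [Transcendental, not_not] at h
    haveI : Algebra.IsAlgebraic k A := ⟨h⟩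
    haveI : Algebra.IsIntegral k A := Algebra.isAlgebraic_iff_isIntegral.mp inferInstance
    exact hA (isField_of_isIntegral_of_isField' (Field.toIsField k))
  obtain ⟨u, hu⟩ := exists_rankAtStalk_eq_one_of_transcendental ha hinjA hbij.1
  apply Module.algebraMap_bijective_iff_rankAtStalk.mp
  funext p
  rw [Pi.one_apply, ← Module.rankAtStalk_eq_of_le_of_finite_of_flat B (bot_le (a := p)),
    Module.rankAtStalk_eq_of_le_of_finite_of_flat B (bot_le (a := u)), hu]

end Summit.ResolutionOfSingularities.ResolutionOfSingularities.Theorems.WildQuotientResolution.Birational
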